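import Summits.ResolutionOfSingularities.ResolutionOfSingularities.Theorems.MarkedIdealsCodimOneSupport
import Summits.ResolutionOfSingularities.ResolutionOfSingularities.Theorems.DimensionGuard
import Literature.AlgebraicGeometry.Resolution.RegularLocalRingsQuotient
import HarnessLib

/-!
# The solid/rest split of the support of an order-bounded marked ideal on a regular scheme

Topic: `Literature/AlgebraicGeometry/Resolution`.  TOOL (decomp-res lens-6 g30), on top of the «solid clause»
(`MarkedIdealsCodimOneSupport`) and the «dimension guard» (`DimensionGuard`).  First consumer: the g31 frame «SurfCut»
of the F-surf-sing door of `E1TopGHeavy` (critic row 221a): the Cossart–Jannsen–Saito surface phase needs a CLOSED subset of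
dimension `≤ 2` of the regular fourfold; the bad locus `supp (I, n)` may have three-dimensional components.  Here, for a marked
ideal `M = (I, n)` with `n ≥ 1` and `ord_y I ≤ n` everywhere (an order-bounded datum) on a regular scheme `X`:

* `MarkedIdeal.solidPart M` = the support points below a support point of codimension one (the union of the codimension-one
  components), `MarkedIdeal.restPart M` = the support points with NO codimension-one support point above them; they partition the
  support (`solidPart_union_restPart`, `disjoint_solidPart_restPart`);
* `coheight_ne_zero_of_mem_support` — no support point is a maximal point of `X` (its local ring would be a field, `I = 0 ≤ 𝔪ⁿ⁺¹`);
  `two_le_coheight_of_mem_restPart` — every point of the rest has codimension `≥ 2`;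
* `isClosed_restPart`, `isClosed_solidPart` — on a Noetherian space with closed support BOTH parts are closed (the support is a
  finite union of irreducible closed sets; by the solid clause's ISOLATION a piece meeting the solid part lies in it, a piece
  meeting the rest lies in it);
* `topologicalKrullDim_restPart_le` — **`dim X ≤ d ⇒ dim (restPart M) ≤ d − 2`** (dimension guard); with `d = 4`: the rest is
  what the surface phase is fed;
* `solidPart_eq_biUnion_closure`, `closure_inter_closure_eq_empty_of_ne` — the solid part is the union of the closures of the
  codimension-one support points, and two distinct such closures are DISJOINT; `finite_codimOnePoints` — there are finitely many;
  `isRegularLocalRing_stalk_quotient_primeOfSpecializes` — each closure is regular: `𝒪_{X,x} ⧸ 𝔭_ζ` is a regular local ring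
  (`𝔭_ζ = (p)`, `p ∉ 𝔪_x²`, Matsumura 14.2 `Literature.AlgebraicGeometry.Resolution.IsRegularLocalRing.quotient_span_singleton`).

So the F-solid move of the frame (blow up the solid part: a regular hypersurface contained in the top locus, a Cartier divisor,
`Y' ≅ Y`, controlled transform `I·𝓘_E^{-n}`) removes the solid part, and the rest — closed, of dimension `≤ 2` — goes to the surface
phase.

## Sources
* H. Matsumura, *Commutative Ring Theory* (CUP 1986), Thm. 14.2, Thm. 14.3, Thm. 20.3. [Matsumura1987]
* A. Grothendieck, EGA IV₁ (Publ. IHÉS 20, 1964), §0.14.1–14.2. [EGAIV1]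
* The Stacks Project, Tags 0052 (Noetherian spaces: finitely many irreducible pieces), 0055, 0AFS. [StacksProject]
* V. Cossart, U. Jannsen, S. Saito, arXiv:0905.2191 — the consumer (embedded resolution in dimension two). [CJS2020]
[new; elementary] [folklore]

[WRITER NOTE (decomp-res writer g14): rider letter row 222c item (8) named
`Literature/AlgebraicGeometry/Resolution/MarkedIdealsSolidSplit.lean`; as for its two imports (gate lint `literature-
cited-only`: uncited new statements belong under `Summits/…`) it lands as
`Summits/ResolutionOfSingularities/ResolutionOfSingularities/Theorems/MarkedIdealsSolidSplit.lean` — module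
`Summits.ResolutionOfSingularities.ResolutionOfSingularities.Theorems.MarkedIdealsSolidSplit`; the ONLY textual changes
are four one-line `[folklore]` docstrings on the `Iff.rfl` / subset lemmas of the split (gate docstring lint) and the two
import lines, now `…Theorems.MarkedIdealsCodimOneSupport` / `…Theorems.DimensionGuard`; namespace
`Literature.AlgebraicGeometry.Resolution(.MarkedIdeal)` and every declaration unchanged. Source of truth: HOME/decomp-
res-lens-6/g30/solid/SolidSplit.lean d7df43370c18.]
-/

noncomputable section

open CategoryTheory CategoryTheory.Limits AlgebraicGeometry TopologicalSpace Topology Order IsLocalRing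

namespace Literature.AlgebraicGeometry.Resolution

universe u

open Scheme.IdealSheafData

section SolidSplit

variable {X : Scheme.{u}}

namespace MarkedIdeal

/-- The **solid part** of the support of a marked ideal: the support points lying below a support point of codimension one
(the union of the codimension-one components of the support). -/
def solidPart (M : MarkedIdeal X) : Set X :=
  {x | x ∈ M.support ∧ ∃ ζ ∈ M.support, Order.coheight ζ = 1 ∧ ζ ⤳ x}

/-- The **rest** of the support: the support points with no codimension-one support point above them. -/
def restPart (M : MarkedIdeal X) : Set X :=
  {x | x ∈ M.support ∧ ∀ ζ ∈ M.support, ζ ⤳ x → Order.coheight ζ ≠ 1}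

variable (M : MarkedIdeal X)

/-- Membership in the solid part `M.solidPart`, unfolded (`Iff.rfl`). [folklore] -/
theorem mem_solidPart_iff (x : X) :
    x ∈ M.solidPart ↔ x ∈ M.support ∧ ∃ ζ ∈ M.support, Order.coheight ζ = 1 ∧ ζ ⤳ x := Iff.rfl

/-- Membership in the rest part `M.restPart`, unfolded (`Iff.rfl`). [folklore] -/
theorem mem_restPart_iff (x : X) :
    x ∈ M.restPart ↔ x ∈ M.support ∧ ∀ ζ ∈ M.support, ζ ⤳ x → Order.coheight ζ ≠ 1 := Iff.rfl

/-- The solid part lies in the support. [folklore] -/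
theorem solidPart_subset_support : M.solidPart ⊆ M.support := fun _ hx => hx.1

/-- The rest part lies in the support. [folklore] -/
theorem restPart_subset_support : M.restPart ⊆ M.support := fun _ hx => hx.1

/-- The two parts cover the support. [new; elementary] [folklore] -/
theorem solidPart_union_restPart : M.solidPart ∪ M.restPart = M.support := by
  ext x
  refine ⟨fun h => h.elim (fun h => h.1) (fun h => h.1), fun hx => ?_⟩
  by_cases h : ∃ ζ ∈ M.support, Order.coheight ζ = 1 ∧ ζ ⤳ x
  · exact Or.inl ⟨hx, h⟩
  · exact Or.inr ⟨hx, fun ζ hζS hζx hζ => h ⟨ζ, hζS, hζ, hζx⟩⟩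

/-- The two parts are disjoint. [new; elementary] [folklore] -/
theorem disjoint_solidPart_restPart : Disjoint M.solidPart M.restPart := by
  rw [Set.disjoint_left]
  rintro x ⟨-, ζ, hζS, hζ, hζx⟩ ⟨-, h⟩
  exact h ζ hζS hζx hζ

variable {M}

/-- The rest is closed under generisation inside the support. [new; elementary] [folklore] -/
theorem mem_restPart_of_specializes {x ξ : X} (hx : x ∈ M.restPart) (hξS : ξ ∈ M.support) (h : ξ ⤳ x) :
    ξ ∈ M.restPart :=
  ⟨hξS, fun ζ hζS hζξ => hx.2 ζ hζS (hζξ.trans h)⟩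

/-- The solid part is closed under specialisation (solid clause: the support contains the whole closure of a codimension-one
support point). [new; elementary] [folklore] -/
theorem mem_solidPart_of_specializes (hX : Scheme.IsRegular X) (hn1 : 1 ≤ M.mult)
    (hord : ∀ y : X, idealOrder M.ideal y ≤ (M.mult : ℕ∞)) {x y : X} (hx : x ∈ M.solidPart) (h : x ⤳ y) :
    y ∈ M.solidPart := by
  obtain ⟨-, ζ, hζS, hζ, hζx⟩ := hx
  exact ⟨mem_support_of_specializes_of_coheight_eq_one hX M hn1 hord hζ hζS (hζx.trans h), ζ, hζS, hζ, hζx.trans h⟩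

/-- **No support point is a maximal point of the regular scheme**: at a point of codimension `0` the local ring is a regular
local ring of dimension `0`, a field, so `I_x = 0 ≤ 𝔪_x^{n+1}` would contradict `ord_x I ≤ n`. [folklore] -/
theorem coheight_ne_zero_of_mem_support (hX : Scheme.IsRegular X) (hn1 : 1 ≤ M.mult)
    (hord : ∀ y : X, idealOrder M.ideal y ≤ (M.mult : ℕ∞)) {x : X} (hx : x ∈ M.support) : Order.coheight x ≠ 0 := by
  intro h0
  haveI : IsRegularLocalRing (X.presheaf.stalk x) := hX x
  have hdim : ringKrullDim (X.presheaf.stalk x) = 0 := by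
    rw [ringKrullDim_stalk_eq_coheight, h0]; rfl
  have hm : maximalIdeal (X.presheaf.stalk x) = ⊥ := by
    have hreg := (isRegularLocalRing_iff (X.presheaf.stalk x)).mp ‹_›
    rw [hdim] at hreg
    have h0' : (maximalIdeal (X.presheaf.stalk x)).spanFinrank = 0 := by exact_mod_cast hreg
    exact (Submodule.spanFinrank_eq_zero_iff_eq_bot (IsNoetherian.noetherian _)).mp h0'
  have hle : stalkIdeal M.ideal x ≤ maximalIdeal (X.presheaf.stalk x) ^ M.mult := (M.mem_support_iff x).mp hx
  have hbot : stalkIdeal M.ideal x = ⊥ := by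
    rw [hm, ← Ideal.zero_eq_bot, zero_pow (by omega), Ideal.zero_eq_bot, le_bot_iff] at hle
    exact hle
  exact not_stalkIdeal_le_pow_succ_of_idealOrder_le (hord x) (by rw [hbot]; exact bot_le)

/-- **Every point of the rest has codimension at least two.** [new; elementary] [folklore] -/
theorem two_le_coheight_of_mem_restPart (hX : Scheme.IsRegular X) (hn1 : 1 ≤ M.mult)
    (hord : ∀ y : X, idealOrder M.ideal y ≤ (M.mult : ℕ∞)) {x : X} (hx : x ∈ M.restPart) :
    (2 : ℕ∞) ≤ Order.coheight x := by
  have h0 := coheight_ne_zero_of_mem_support hX hn1 hord hx.1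
  have h1 : Order.coheight x ≠ 1 := hx.2 x hx.1 specializes_rfl
  cases h : Order.coheight x with
  | top => exact le_top
  | coe k =>
    rw [h] at h0 h1
    have h0' : k ≠ 0 := fun e => h0 (by rw [e]; rfl)
    have h1' : k ≠ 1 := fun e => h1 (by rw [e]; rfl)
    exact_mod_cast (show 2 ≤ k by omega)

/-- An irreducible closed subset of the support meeting the rest lies in the rest (isolation of the codimension-one
components, `specializes_of_mem_support_of_coheight_eq_one`). [new; elementary] [folklore] -/
theorem subset_restPart_of_isIrreducible (hX : Scheme.IsRegular X) (hn1 : 1 ≤ M.mult)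
    (hord : ∀ y : X, idealOrder M.ideal y ≤ (M.mult : ℕ∞)) {T : Set X} (hT : IsIrreducible T) (hTc : IsClosed T)
    (hTS : T ⊆ M.support) {x : X} (hxT : x ∈ T) (hx : x ∈ M.restPart) : T ⊆ M.restPart := by
  -- the generic point of `T`
  set ξ := hT.genericPoint with hξdef
  have hgen : IsGenericPoint ξ (closure T) := hT.isGenericPoint_genericPoint_closure
  rw [hTc.closure_eq] at hgen
  have hξT : ξ ∈ T := hgen.mem
  have hξx : ξ ⤳ x := hgen.specializes hxT
  have hξR : ξ ∈ M.restPart := mem_restPart_of_specializes hx (hTS hξT) hξx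
  intro y hyT
  refine ⟨hTS hyT, fun ζ hζS hζy hζ => ?_⟩
  have hζξ : ζ ⤳ ξ :=
    specializes_of_mem_support_of_coheight_eq_one hX M hn1 hord hζ hζS hζy (hgen.specializes hyT) (hTS hξT)
  exact hξR.2 ζ hζS hζξ hζ

/-- An irreducible closed subset of the support meeting the solid part lies in the solid part. [new; elementary] [folklore] -/
theorem subset_solidPart_of_isIrreducible (hX : Scheme.IsRegular X) (hn1 : 1 ≤ M.mult)
    (hord : ∀ y : X, idealOrder M.ideal y ≤ (M.mult : ℕ∞)) {T : Set X} (hT : IsIrreducible T) (hTc : IsClosed T)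
    (hTS : T ⊆ M.support) {x : X} (hxT : x ∈ T) (hx : x ∈ M.solidPart) : T ⊆ M.solidPart := by
  set ξ := hT.genericPoint with hξdef
  have hgen : IsGenericPoint ξ (closure T) := hT.isGenericPoint_genericPoint_closure
  rw [hTc.closure_eq] at hgen
  have hξT : ξ ∈ T := hgen.mem
  obtain ⟨-, ζ, hζS, hζ, hζx⟩ := hx
  have hζξ : ζ ⤳ ξ :=
    specializes_of_mem_support_of_coheight_eq_one hX M hn1 hord hζ hζS hζx (hgen.specializes hxT) (hTS hξT)
  intro y hyT
  exact ⟨hTS hyT, ζ, hζS, hζ, hζξ.trans (hgen.specializes hyT)⟩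

/-- **The rest is closed** (Noetherian space, closed support): it is the union of those irreducible closed pieces of the
support that meet it. [new; elementary] [folklore] -/
theorem isClosed_restPart [NoetherianSpace X] (hX : Scheme.IsRegular X) (hn1 : 1 ≤ M.mult)
    (hord : ∀ y : X, idealOrder M.ideal y ≤ (M.mult : ℕ∞)) (hS : IsClosed M.support) : IsClosed M.restPart := by
  obtain ⟨𝒯, h𝒯f, h𝒯c, h𝒯i, hS𝒯⟩ := NoetherianSpace.exists_finite_set_isClosed_irreducible hS
  have key : M.restPart = ⋃ T ∈ {T ∈ 𝒯 | T ⊆ M.restPart}, T := by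
    ext x
    simp only [Set.mem_iUnion, Set.mem_setOf_eq, exists_prop]
    constructor
    · intro hx
      have hxS : x ∈ ⋃₀ 𝒯 := hS𝒯 ▸ hx.1
      obtain ⟨T, hT𝒯, hxT⟩ := Set.mem_sUnion.mp hxS
      have hTS : T ⊆ M.support := fun y hy => hS𝒯 ▸ Set.mem_sUnion.mpr ⟨T, hT𝒯, hy⟩
      exact ⟨T, ⟨hT𝒯, subset_restPart_of_isIrreducible hX hn1 hord (h𝒯i T hT𝒯) (h𝒯c T hT𝒯) hTS hxT hx⟩, hxT⟩
    · rintro ⟨T, ⟨-, hTR⟩, hxT⟩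
      exact hTR hxT
  rw [key]
  exact (h𝒯f.subset (Set.sep_subset _ _)).isClosed_biUnion fun T hT => h𝒯c T hT.1

/-- **The solid part is closed** (same argument). [new; elementary] [folklore] -/
theorem isClosed_solidPart [NoetherianSpace X] (hX : Scheme.IsRegular X) (hn1 : 1 ≤ M.mult)
    (hord : ∀ y : X, idealOrder M.ideal y ≤ (M.mult : ℕ∞)) (hS : IsClosed M.support) : IsClosed M.solidPart := by
  obtain ⟨𝒯, h𝒯f, h𝒯c, h𝒯i, hS𝒯⟩ := NoetherianSpace.exists_finite_set_isClosed_irreducible hS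
  have key : M.solidPart = ⋃ T ∈ {T ∈ 𝒯 | T ⊆ M.solidPart}, T := by
    ext x
    simp only [Set.mem_iUnion, Set.mem_setOf_eq, exists_prop]
    constructor
    · intro hx
      have hxS : x ∈ ⋃₀ 𝒯 := hS𝒯 ▸ hx.1
      obtain ⟨T, hT𝒯, hxT⟩ := Set.mem_sUnion.mp hxS
      have hTS : T ⊆ M.support := fun y hy => hS𝒯 ▸ Set.mem_sUnion.mpr ⟨T, hT𝒯, hy⟩
      exact ⟨T, ⟨hT𝒯, subset_solidPart_of_isIrreducible hX hn1 hord (h𝒯i T hT𝒯) (h𝒯c T hT𝒯) hTS hxT hx⟩, hxT⟩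
    · rintro ⟨T, ⟨-, hTR⟩, hxT⟩
      exact hTR hxT
  rw [key]
  exact (h𝒯f.subset (Set.sep_subset _ _)).isClosed_biUnion fun T hT => h𝒯c T hT.1

/-- **Dimension guard for the rest**: on a regular scheme of dimension `≤ d` (Noetherian space, closed support) the rest of
the support of an order-bounded marked ideal has dimension `≤ d − 2`.  With `d = 4`: the surface phase is fed a closed subset of
dimension `≤ 2`. [cite: EGAIV1, §0.14.2] -/
theorem topologicalKrullDim_restPart_le [NoetherianSpace X] (hX : Scheme.IsRegular X) (hn1 : 1 ≤ M.mult)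
    (hord : ∀ y : X, idealOrder M.ideal y ≤ (M.mult : ℕ∞)) (hS : IsClosed M.support) {d : ℕ}
    (hd : topologicalKrullDim X ≤ d) : topologicalKrullDim M.restPart ≤ ((d - 2 : ℕ) : WithBot ℕ∞) :=
  topologicalKrullDim_coe_le_of_forall_exists_specializes hd (isClosed_restPart hX hn1 hord hS)
    fun x hx => ⟨x, hx, specializes_rfl, two_le_coheight_of_mem_restPart hX hn1 hord hx⟩

/-- The solid part is the union of the closures of the codimension-one support points. [new; elementary] [folklore] -/
theorem solidPart_eq_biUnion_closure (hX : Scheme.IsRegular X) (hn1 : 1 ≤ M.mult)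
    (hord : ∀ y : X, idealOrder M.ideal y ≤ (M.mult : ℕ∞)) :
    M.solidPart = ⋃ ζ ∈ {ζ ∈ M.support | Order.coheight ζ = 1}, closure {ζ} := by
  ext x
  simp only [Set.mem_iUnion, Set.mem_setOf_eq, exists_prop]
  constructor
  · rintro ⟨-, ζ, hζS, hζ, hζx⟩
    exact ⟨ζ, ⟨hζS, hζ⟩, specializes_iff_mem_closure.mp hζx⟩
  · rintro ⟨ζ, ⟨hζS, hζ⟩, hx⟩
    have hζx : ζ ⤳ x := specializes_iff_mem_closure.mpr hx
    exact ⟨mem_support_of_specializes_of_coheight_eq_one hX M hn1 hord hζ hζS hζx, ζ, hζS, hζ, hζx⟩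

/-- **Two distinct codimension-one components of the support are disjoint** (a common point would, by isolation, force
`ζ ⤳ ζ'` and `ζ' ⤳ ζ`). [new; elementary] [folklore] -/
theorem closure_inter_closure_eq_empty_of_ne (hX : Scheme.IsRegular X) (hn1 : 1 ≤ M.mult)
    (hord : ∀ y : X, idealOrder M.ideal y ≤ (M.mult : ℕ∞)) {ζ ζ' : X} (hζ : Order.coheight ζ = 1) (hζS : ζ ∈ M.support)
    (hζ' : Order.coheight ζ' = 1) (hζ'S : ζ' ∈ M.support) (hne : ζ ≠ ζ') :
    closure ({ζ} : Set X) ∩ closure {ζ'} = ∅ := by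
  rw [Set.eq_empty_iff_forall_notMem]
  rintro x ⟨hx, hx'⟩
  have h1 : ζ ⤳ x := specializes_iff_mem_closure.mpr hx
  have h2 : ζ' ⤳ x := specializes_iff_mem_closure.mpr hx'
  have h12 : ζ ⤳ ζ' := specializes_of_mem_support_of_coheight_eq_one hX M hn1 hord hζ hζS h1 h2 hζ'S
  have h21 : ζ' ⤳ ζ := specializes_of_mem_support_of_coheight_eq_one hX M hn1 hord hζ' hζ'S h2 h1 hζS
  exact hne (h12.antisymm h21).eq

/-- A specialisation from a point of positive codimension onto a point of codimension one is trivial. [folklore] -/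
theorem eq_of_specializes_of_coheight_eq_one' {ξ ζ : X} (h : ξ ⤳ ζ) (hζ : Order.coheight ζ = 1)
    (hξ : Order.coheight ξ ≠ 0) : ξ = ζ := by
  by_contra hne
  have hle : ζ ≤ ξ := h
  have hlt : ζ < ξ := lt_of_le_not_ge hle fun h' => hne (Specializes.antisymm h (show ζ ⤳ ξ from h')).eq
  have h1 := Order.coheight_add_one_le hlt
  rw [hζ] at h1
  cases hk : Order.coheight ξ with
  | top => rw [hk] at h1; exact absurd h1 (by decide)
  | coe k =>
    rw [hk] at h1 hξ
    have h2 : k + 1 ≤ 1 := by exact_mod_cast h1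
    exact hξ (by rw [show k = 0 by omega]; rfl)

/-- **Finitely many codimension-one support points** (Noetherian space, closed support): each is the generic point of one of
the finitely many irreducible closed pieces of the support. [cite: StacksProject, Tag 0052] -/
theorem finite_codimOnePoints [NoetherianSpace X] (hX : Scheme.IsRegular X) (hn1 : 1 ≤ M.mult)
    (hord : ∀ y : X, idealOrder M.ideal y ≤ (M.mult : ℕ∞)) (hS : IsClosed M.support) :
    {ζ ∈ M.support | Order.coheight ζ = 1}.Finite := by
  obtain ⟨𝒯, h𝒯f, h𝒯c, h𝒯i, hS𝒯⟩ := NoetherianSpace.exists_finite_set_isClosed_irreducible hS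
  refine (h𝒯f.biUnion (t := fun T => {x : X | IsGenericPoint x T}) fun T _ => ?_).subset ?_
  · have hsub : ({x : X | IsGenericPoint x T}).Subsingleton := fun x hx y hy => IsGenericPoint.eq hx hy
    exact hsub.finite
  · rintro ζ ⟨hζS, hζ⟩
    simp only [Set.mem_iUnion, Set.mem_setOf_eq, exists_prop]
    have hζS' : ζ ∈ ⋃₀ 𝒯 := hS𝒯 ▸ hζS
    obtain ⟨T, hT𝒯, hζT⟩ := Set.mem_sUnion.mp hζS'
    have hTS : T ⊆ M.support := fun y hy => hS𝒯 ▸ Set.mem_sUnion.mpr ⟨T, hT𝒯, hy⟩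
    have hgen : IsGenericPoint (h𝒯i T hT𝒯).genericPoint (closure T) :=
      (h𝒯i T hT𝒯).isGenericPoint_genericPoint_closure
    rw [(h𝒯c T hT𝒯).closure_eq] at hgen
    have hξζ : (h𝒯i T hT𝒯).genericPoint ⤳ ζ := hgen.specializes hζT
    have hξ0 := coheight_ne_zero_of_mem_support hX hn1 hord (hTS hgen.mem)
    have heq := eq_of_specializes_of_coheight_eq_one' hξζ hζ hξ0
    exact ⟨T, hT𝒯, heq ▸ hgen⟩

/-- **Each codimension-one component of the support is regular**: at every point `x` of `cl{ζ}` the local ring of the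
component, `𝒪_{X,x} ⧸ 𝔭_ζ = 𝒪_{X,x} ⧸ (p)` with `p ∉ 𝔪_x²`, is a regular local ring (Matsumura 14.2). [cite: Matsumura1987, Thm. 14.2] -/
theorem isRegularLocalRing_stalk_quotient_primeOfSpecializes (hX : Scheme.IsRegular X) (hn1 : 1 ≤ M.mult)
    (hord : ∀ y : X, idealOrder M.ideal y ≤ (M.mult : ℕ∞)) {ζ : X} (hζ : Order.coheight ζ = 1) (hζS : ζ ∈ M.support)
    {x : X} (h : ζ ⤳ x) : IsRegularLocalRing (X.presheaf.stalk x ⧸ primeOfSpecializes h) := by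
  haveI := hX x
  obtain ⟨p, -, hpeq, hp2, -⟩ := exists_generator_of_mem_support_of_coheight_eq_one hX M hn1 hord hζ hζS h
  have hpm : p ∈ maximalIdeal (X.presheaf.stalk x) := by
    have hne : primeOfSpecializes h ≠ ⊤ := Ideal.IsPrime.ne_top inferInstance
    have : p ∈ primeOfSpecializes h := by rw [hpeq]; exact Ideal.mem_span_singleton_self p
    exact IsLocalRing.le_maximalIdeal hne this
  rw [hpeq]
  exact (IsRegularLocalRing.quotient_span_singleton hpm hp2).1

end MarkedIdeal

end SolidSplit

end Literature.AlgebraicGeometry.Resolution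

end
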